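import Summits.RiemannHypothesis.RiemannHypothesis.Theorems.SemilocalDeletionChain
import Summits.RiemannHypothesis.RiemannHypothesis.Theorems.SemilocalDeletionPairFloor
import HarnessLib

/-!
# The pair CEILING: the signed Perron 4-path comb attains the two-prime floor `−ρ₄`

Completes `SemilocalDeletionPairFloor.lean` (floor `λ_min(S∖{p₁,p₂}; c; P) ≥ λ_min(S; c; P) − ρ₄` for spread lags) to a
SANDWICH, using the comb machinery of `SemilocalDeletionChain.lean`: on the 4-path `f — a — b — e` of the orbit graph
(nodes `a = −c + δ`, `e = a + (L₂ − L₁)`, `f = a + L₁`, `b = a + L₂`, `L_i = log p_i`) put the blocks `h(· − node)` with the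
signed Perron weights `(−1, −θ, +θ, +1)`, `θ = w₁/ρ₄`.  If the lags are resolved by the block width (`2δ < L₂ − L₁`,
`2δ < 2L₁ − L₂`) and the comb fits (`L₂ + 2δ ≤ 2c`), then the lag sums are `E_{p₁} = −2θ`, `E_{p₂} = −1`
(`lagSum_four_path`), the signed Perron relation `2(w₁E₁ + w₂E₂) = −ρ₄(2 + 2θ²)` IS the Perron equation `w₁² + w₂ρ₄ = ρ₄²`,
and `SemilocalDeletionChain.semilocalGroundEnergy_sdiff_add_mul_le` gives

  `(λ_min(S∖{p₁,p₂}; c) + ρ₄)·(2 + 2θ²)‖h‖₂² ≤ Re Q_S(comb_h)`   (`semilocalGroundEnergy_sdiff_pair_add_mul_le`).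

So `0 ≤ λ_min(S∖{p₁,p₂}; c) − (λ_min(S; c) − ρ₄)` (floor, spread case) and `λ_min(S∖{p₁,p₂}; c) + ρ₄ ≤ D_comb` (this file): the
two-prime cliff is pinned to `−ρ₄` up to the undeleted form's energy on 4-path combs of half-width `δ` — the multi-prime
analogue of the dipole sandwich.  Certified numerics (b = 9/5, free odd): `U∖{11,23}` −1.11254, `U∖{13,23}` −1.10378 vs
`−ρ₄` = −1.12033 / −1.10980.  Nothing here bears on RH.
-/

set_option linter.dupNamespace false

noncomputable section

open Complex Filter Set MeasureTheory
open scoped Real Topology ComplexConjugate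

namespace Summit.RiemannHypothesis.RiemannHypothesis.Theorems.SemilocalDeletionPairCeiling

open Literature.NumberTheory.LFunctions
open Summit.RiemannHypothesis.RiemannHypothesis.Theorems.SemilocalDeletionCliff
open Summit.RiemannHypothesis.RiemannHypothesis.Theorems.SemilocalDeletionSchurFloor
open Summit.RiemannHypothesis.RiemannHypothesis.Theorems.SemilocalDeletionChain
open Summit.RiemannHypothesis.RiemannHypothesis.Theorems.SemilocalDeletionPairFloor
open Summit.RiemannHypothesis.RiemannHypothesis.Theorems.HandoffSemilocalEnergy

variable {h : ℝ → ℂ} {δ c L₁ L₂ θ : ℝ}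

/-! ## §1  The signed 4-path comb: nodes `a = −c+δ`, `e = a + (L₂ − L₁)`, `f = a + L₁`, `b = a + L₂`; signs `(−1, −θ, +θ, +1)` -/

/-- The node positions, as a table indexed by `ℕ` (`0 ↦ a`, `1 ↦ e`, `2 ↦ f`, `3 ↦ b`). -/
theorem nodes_apply (c δ L₁ L₂ : ℝ) :
    (fun i : ℕ ↦ [-c + δ, -c + δ + (L₂ - L₁), -c + δ + L₁, -c + δ + L₂].getD i 0) 0 = -c + δ ∧
    (fun i : ℕ ↦ [-c + δ, -c + δ + (L₂ - L₁), -c + δ + L₁, -c + δ + L₂].getD i 0) 1 = -c + δ + (L₂ - L₁) ∧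
    (fun i : ℕ ↦ [-c + δ, -c + δ + (L₂ - L₁), -c + δ + L₁, -c + δ + L₂].getD i 0) 2 = -c + δ + L₁ ∧
    (fun i : ℕ ↦ [-c + δ, -c + δ + (L₂ - L₁), -c + δ + L₁, -c + δ + L₂].getD i 0) 3 = -c + δ + L₂ := by
  simp

/-- **The lag sums of the 4-path comb.**  With signs `(−1, −θ, θ, 1)` on the nodes `(a, e, f, b)` and the geometry
`2δ < L₂ − L₁`, `2δ < 2L₁ − L₂` (so all pairwise node distances differ from the two lags by more than `2δ` unless they equal
them): the lag-`L₁` pairs are `(f, a)`, `(b, e)` with `Σ b_i b_j = −2θ`, the lag-`L₂` pair is `(b, a)` with `Σ b_i b_j = −1`. -/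
theorem lagSum_four_path (hd : 0 < L₂ - L₁) (hd' : 0 < 2 * L₁ - L₂) :
    (∑ q ∈ (Finset.range 4 ×ˢ Finset.range 4).filter
        (fun q ↦ [-c + δ, -c + δ + (L₂ - L₁), -c + δ + L₁, -c + δ + L₂].getD q.1 (0 : ℝ) -
          [-c + δ, -c + δ + (L₂ - L₁), -c + δ + L₁, -c + δ + L₂].getD q.2 0 = L₁),
        [-1, -θ, θ, 1].getD q.1 (0 : ℝ) * [-1, -θ, θ, 1].getD q.2 0) = -2 * θ ∧
    (∑ q ∈ (Finset.range 4 ×ˢ Finset.range 4).filter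
        (fun q ↦ [-c + δ, -c + δ + (L₂ - L₁), -c + δ + L₁, -c + δ + L₂].getD q.1 (0 : ℝ) -
          [-c + δ, -c + δ + (L₂ - L₁), -c + δ + L₁, -c + δ + L₂].getD q.2 0 = L₂),
        [-1, -θ, θ, 1].getD q.1 (0 : ℝ) * [-1, -θ, θ, 1].getD q.2 0) = -1 := by
  constructor
  · rw [Finset.sum_filter, Finset.sum_product]
    simp only [Finset.sum_range_succ, Finset.sum_range_zero, zero_add, List.getD_cons_zero, List.getD_cons_succ]
    have e1 : ¬ (-c + δ - (-c + δ) = L₁) := by intro h; linarith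
    have e2 : ¬ (-c + δ - (-c + δ + (L₂ - L₁)) = L₁) := by intro h; linarith
    have e3 : ¬ (-c + δ - (-c + δ + L₁) = L₁) := by intro h; linarith
    have e4 : ¬ (-c + δ - (-c + δ + L₂) = L₁) := by intro h; linarith
    have e5 : ¬ (-c + δ + (L₂ - L₁) - (-c + δ) = L₁) := by intro h; linarith
    have e6 : ¬ (-c + δ + (L₂ - L₁) - (-c + δ + (L₂ - L₁)) = L₁) := by intro h; linarith
    have e7 : ¬ (-c + δ + (L₂ - L₁) - (-c + δ + L₁) = L₁) := by intro h; linarith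
    have e8 : ¬ (-c + δ + (L₂ - L₁) - (-c + δ + L₂) = L₁) := by intro h; linarith
    have e9 : (-c + δ + L₁ - (-c + δ) = L₁) := by ring
    have e10 : ¬ (-c + δ + L₁ - (-c + δ + (L₂ - L₁)) = L₁) := by intro h; linarith
    have e11 : ¬ (-c + δ + L₁ - (-c + δ + L₁) = L₁) := by intro h; linarith
    have e12 : ¬ (-c + δ + L₁ - (-c + δ + L₂) = L₁) := by intro h; linarith
    have e13 : ¬ (-c + δ + L₂ - (-c + δ) = L₁) := by intro h; linarith
    have e14 : (-c + δ + L₂ - (-c + δ + (L₂ - L₁)) = L₁) := by ring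
    have e15 : ¬ (-c + δ + L₂ - (-c + δ + L₁) = L₁) := by intro h; linarith
    have e16 : ¬ (-c + δ + L₂ - (-c + δ + L₂) = L₁) := by intro h; linarith
    simp only [e1, e2, e3, e4, e5, e6, e7, e8, e9, e10, e11, e12, e13, e14, e15, e16, if_true, if_false]
    ring
  · rw [Finset.sum_filter, Finset.sum_product]
    simp only [Finset.sum_range_succ, Finset.sum_range_zero, zero_add, List.getD_cons_zero, List.getD_cons_succ]
    have e1 : ¬ (-c + δ - (-c + δ) = L₂) := by intro h; linarith
    have e2 : ¬ (-c + δ - (-c + δ + (L₂ - L₁)) = L₂) := by intro h; linarith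
    have e3 : ¬ (-c + δ - (-c + δ + L₁) = L₂) := by intro h; linarith
    have e4 : ¬ (-c + δ - (-c + δ + L₂) = L₂) := by intro h; linarith
    have e5 : ¬ (-c + δ + (L₂ - L₁) - (-c + δ) = L₂) := by intro h; linarith
    have e6 : ¬ (-c + δ + (L₂ - L₁) - (-c + δ + (L₂ - L₁)) = L₂) := by intro h; linarith
    have e7 : ¬ (-c + δ + (L₂ - L₁) - (-c + δ + L₁) = L₂) := by intro h; linarith
    have e8 : ¬ (-c + δ + (L₂ - L₁) - (-c + δ + L₂) = L₂) := by intro h; linarith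
    have e9 : ¬ (-c + δ + L₁ - (-c + δ) = L₂) := by intro h; linarith
    have e10 : ¬ (-c + δ + L₁ - (-c + δ + (L₂ - L₁)) = L₂) := by intro h; linarith
    have e11 : ¬ (-c + δ + L₁ - (-c + δ + L₁) = L₂) := by intro h; linarith
    have e12 : ¬ (-c + δ + L₁ - (-c + δ + L₂) = L₂) := by intro h; linarith
    have e13 : (-c + δ + L₂ - (-c + δ) = L₂) := by ring
    have e14 : ¬ (-c + δ + L₂ - (-c + δ + (L₂ - L₁)) = L₂) := by intro h; linarith
    have e15 : ¬ (-c + δ + L₂ - (-c + δ + L₁) = L₂) := by intro h; linarith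
    have e16 : ¬ (-c + δ + L₂ - (-c + δ + L₂) = L₂) := by intro h; linarith
    simp only [e1, e2, e3, e4, e5, e6, e7, e8, e9, e10, e11, e12, e13, e14, e15, e16, if_true, if_false]
    ring


/-! ## §2  The ceiling: the signed Perron 4-path comb -/

variable {S : Finset ℕ} {p₁ p₂ : ℕ}

set_option maxHeartbeats 400000 in
/-- **THE PAIR CEILING (4-path comb), with a constraint.**  Let `p₁ ≠ p₂` be primes in `S` with `c < log p₁`, `L_i = log p_i`, and suppose the
lags are RESOLVED by the block width: `2δ < L₂ − L₁`, `2δ < 2L₁ − L₂`, and the comb fits: `L₂ + 2δ ≤ 2c`, `0 ≤ δ`.  For a block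
`h ∈ C(δ)` put the signed Perron comb on the 4-path `f — a — b — e` (nodes `a = −c+δ`, `e = a + L₂ − L₁`, `f = a + L₁`,
`b = a + L₂`; signs `−1, −θ, +θ, +1` on `a, e, f, b`, `θ = w₁/ρ₄`).  Then
`(λ_min(S∖{p₁,p₂}; c) + ρ₄)·(2 + 2θ²)‖h‖₂² ≤ Re Q_S(comb)`, `ρ₄ = (w₂ + √(w₂² + 4w₁²))/2` — the multi-deletion floor `−ρ₄`
of `SemilocalDeletionPairFloor` (spread case) is ATTAINED up to the undeleted form's energy on the comb.  Version for the
bottom under a constraint `P` containing the comb and its positive multiples (e.g. a parity sector when the comb is centred). -/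
theorem semilocalGroundEnergy_sdiff_pair_add_mul_le_of_constraint {P : (ℝ → ℂ) → Prop} (hh : IsWeilTest h)
    (hsupp : tsupport h ⊆ Icc (-δ) δ) (hδ : 0 ≤ δ)
    (hp₁ : p₁.Prime) (hp₂ : p₂.Prime) (h1S : p₁ ∈ S) (h2S : p₂ ∈ S) (hne : p₁ ≠ p₂) (hc1 : c < Real.log p₁)
    (hd : 2 * δ < Real.log p₂ - Real.log p₁) (hd' : 2 * δ < 2 * Real.log p₁ - Real.log p₂)
    (hfit : Real.log p₂ + 2 * δ ≤ 2 * c)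
    (hP : ∀ r : ℝ, 0 < r → P fun t ↦ (r : ℂ) * ∑ i ∈ Finset.range 4,
        (([-1, -((Real.log p₁ / Real.sqrt p₁) /
              ((Real.log p₂ / Real.sqrt p₂ + Real.sqrt ((Real.log p₂ / Real.sqrt p₂) ^ 2 + 4 * (Real.log p₁ / Real.sqrt p₁) ^ 2)) / 2)),
            (Real.log p₁ / Real.sqrt p₁) /
              ((Real.log p₂ / Real.sqrt p₂ + Real.sqrt ((Real.log p₂ / Real.sqrt p₂) ^ 2 + 4 * (Real.log p₁ / Real.sqrt p₁) ^ 2)) / 2),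
            1].getD i (0 : ℝ) : ℝ) : ℂ) *
          h (t - [-c + δ, -c + δ + (Real.log p₂ - Real.log p₁), -c + δ + Real.log p₁, -c + δ + Real.log p₂].getD i 0)) :
    (semilocalGroundEnergy (S \ {p₁, p₂}) P c +
        (Real.log p₂ / Real.sqrt p₂ + Real.sqrt ((Real.log p₂ / Real.sqrt p₂) ^ 2 + 4 * (Real.log p₁ / Real.sqrt p₁) ^ 2)) / 2) *
      ((∑ i ∈ Finset.range 4,
          ([-1, -((Real.log p₁ / Real.sqrt p₁) /
              ((Real.log p₂ / Real.sqrt p₂ + Real.sqrt ((Real.log p₂ / Real.sqrt p₂) ^ 2 + 4 * (Real.log p₁ / Real.sqrt p₁) ^ 2)) / 2)),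
            (Real.log p₁ / Real.sqrt p₁) /
              ((Real.log p₂ / Real.sqrt p₂ + Real.sqrt ((Real.log p₂ / Real.sqrt p₂) ^ 2 + 4 * (Real.log p₁ / Real.sqrt p₁) ^ 2)) / 2),
            1].getD i (0 : ℝ)) ^ 2) * ∫ u : ℝ, ‖h u‖ ^ 2) ≤
      (weilSemilocalQuadratic S (fun t ↦ ∑ i ∈ Finset.range 4,
        (([-1, -((Real.log p₁ / Real.sqrt p₁) /
              ((Real.log p₂ / Real.sqrt p₂ + Real.sqrt ((Real.log p₂ / Real.sqrt p₂) ^ 2 + 4 * (Real.log p₁ / Real.sqrt p₁) ^ 2)) / 2)),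
            (Real.log p₁ / Real.sqrt p₁) /
              ((Real.log p₂ / Real.sqrt p₂ + Real.sqrt ((Real.log p₂ / Real.sqrt p₂) ^ 2 + 4 * (Real.log p₁ / Real.sqrt p₁) ^ 2)) / 2),
            1].getD i (0 : ℝ) : ℝ) : ℂ) *
          h (t - [-c + δ, -c + δ + (Real.log p₂ - Real.log p₁), -c + δ + Real.log p₁, -c + δ + Real.log p₂].getD i 0))).re := by
  -- abbreviations
  set L₁ : ℝ := Real.log p₁ with hL₁
  set L₂ : ℝ := Real.log p₂ with hL₂
  set w₁ : ℝ := Real.log p₁ / Real.sqrt p₁ with hw₁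
  set w₂ : ℝ := Real.log p₂ / Real.sqrt p₂ with hw₂
  have hw₁pos : 0 < w₁ := div_pos (Real.log_pos (by exact_mod_cast hp₁.one_lt)) (Real.sqrt_pos.2 (by exact_mod_cast hp₁.pos))
  have hw₂nn : 0 ≤ w₂ := div_nonneg (Real.log_nonneg (by exact_mod_cast hp₂.one_lt.le)) (Real.sqrt_nonneg _)
  obtain ⟨hPer, hρ1, hρ⟩ := perronFour_spec hw₁pos hw₂nn
  set ρ : ℝ := (w₂ + Real.sqrt (w₂ ^ 2 + 4 * w₁ ^ 2)) / 2 with hρdef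
  set θ : ℝ := w₁ / ρ with hθ
  have hL₁pos : 0 < L₁ := Real.log_pos (by exact_mod_cast hp₁.one_lt)
  have hdpos : 0 < L₂ - L₁ := by linarith
  have hd'pos : 0 < 2 * L₁ - L₂ := by linarith
  -- the data for `semilocalGroundEnergy_sdiff_add_mul_le`
  have hDS : ({p₁, p₂} : Finset ℕ) ⊆ S := by
    intro p hp; simp only [Finset.mem_insert, Finset.mem_singleton] at hp
    rcases hp with rfl | rfl
    · exact h1S
    · exact h2S
  have hprime : ∀ p ∈ ({p₁, p₂} : Finset ℕ), p.Prime := by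
    intro p hp; simp only [Finset.mem_insert, Finset.mem_singleton] at hp
    rcases hp with rfl | rfl
    · exact hp₁
    · exact hp₂
  have hlog : ∀ p ∈ ({p₁, p₂} : Finset ℕ), c < Real.log p := by
    intro p hp; simp only [Finset.mem_insert, Finset.mem_singleton] at hp
    rcases hp with rfl | rfl
    · exact hc1
    · linarith
  have hx : ∀ i ∈ Finset.range 4, [-c + δ, -c + δ + (L₂ - L₁), -c + δ + L₁, -c + δ + L₂].getD i (0 : ℝ) ∈ Icc (-(c - δ)) (c - δ) := by
    intro i hi
    rw [Finset.mem_range] at hi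
    interval_cases i <;> simp only [List.getD_cons_zero, List.getD_cons_succ, mem_Icc] <;> constructor <;> linarith
  have hsep : ∀ i ∈ Finset.range 4, ∀ j ∈ Finset.range 4, i ≠ j →
      2 * δ < |[-c + δ, -c + δ + (L₂ - L₁), -c + δ + L₁, -c + δ + L₂].getD i (0 : ℝ) -
        [-c + δ, -c + δ + (L₂ - L₁), -c + δ + L₁, -c + δ + L₂].getD j 0| := by
    intro i hi j hj hij
    rw [Finset.mem_range] at hi hj
    interval_cases i <;> interval_cases j <;>
      simp only [List.getD_cons_zero, List.getD_cons_succ, lt_abs] <;>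
      first | exact absurd rfl hij | (left; linarith) | (right; linarith)
  have hres : ∀ p ∈ ({p₁, p₂} : Finset ℕ), ∀ i ∈ Finset.range 4, ∀ j ∈ Finset.range 4,
      [-c + δ, -c + δ + (L₂ - L₁), -c + δ + L₁, -c + δ + L₂].getD i (0 : ℝ) -
          [-c + δ, -c + δ + (L₂ - L₁), -c + δ + L₁, -c + δ + L₂].getD j 0 = Real.log p ∨
        2 * δ < |Real.log p - ([-c + δ, -c + δ + (L₂ - L₁), -c + δ + L₁, -c + δ + L₂].getD i (0 : ℝ) -
          [-c + δ, -c + δ + (L₂ - L₁), -c + δ + L₁, -c + δ + L₂].getD j 0)| := by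
    intro p hp i hi j hj
    simp only [Finset.mem_insert, Finset.mem_singleton] at hp
    rw [Finset.mem_range] at hi hj
    rcases hp with rfl | rfl
    · rw [← hL₁]
      interval_cases i <;> interval_cases j <;>
        simp only [List.getD_cons_zero, List.getD_cons_succ, lt_abs] <;>
        first | (left; linarith) | (right; left; linarith) | (right; right; linarith)
    · rw [← hL₂]
      interval_cases i <;> interval_cases j <;>
        simp only [List.getD_cons_zero, List.getD_cons_succ, lt_abs] <;>
        first | (left; linarith) | (right; left; linarith)
  have hlag := lagSum_four_path (c := c) (δ := δ) (θ := θ) hdpos hd'pos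
  have hPerron : 2 * ∑ p ∈ ({p₁, p₂} : Finset ℕ), Real.log p / Real.sqrt p *
      ∑ q ∈ (Finset.range 4 ×ˢ Finset.range 4).filter
        (fun q ↦ [-c + δ, -c + δ + (L₂ - L₁), -c + δ + L₁, -c + δ + L₂].getD q.1 (0 : ℝ) -
          [-c + δ, -c + δ + (L₂ - L₁), -c + δ + L₁, -c + δ + L₂].getD q.2 0 = Real.log p),
        [-1, -θ, θ, 1].getD q.1 (0 : ℝ) * [-1, -θ, θ, 1].getD q.2 0 =
      -ρ * ∑ i ∈ Finset.range 4, ([-1, -θ, θ, 1].getD i (0 : ℝ)) ^ 2 := by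
    rw [Finset.sum_pair hne, ← hL₁, ← hL₂, ← hw₁, ← hw₂, hlag.1, hlag.2]
    simp only [Finset.sum_range_succ, Finset.sum_range_zero, zero_add, List.getD_cons_zero, List.getD_cons_succ]
    have hρθ : ρ * θ = w₁ := by rw [hθ]; field_simp
    have hkey : w₁ * θ + w₂ = ρ := by
      have : w₁ * θ = w₁ ^ 2 / ρ := by rw [hθ]; ring
      rw [this, div_add' _ _ _ hρ.ne', div_eq_iff hρ.ne']
      nlinarith [hPer]
    nlinarith [hρθ, hkey]
  have hmain := semilocalGroundEnergy_sdiff_add_mul_le (P := P) (c := c) hh hsupp hδ (Finset.range 4)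
    (fun i ↦ [-1, -θ, θ, 1].getD i (0 : ℝ)) hx hsep {p₁, p₂} hDS hprime hlog hres hPerron hP
  exact hmain

/-- **THE PAIR CEILING (4-path comb), all sectors**: `(λ_min(S∖{p₁,p₂}; c) + ρ₄)·(2 + 2θ²)‖h‖₂² ≤ Re Q_S(comb)` under the
hypotheses of `semilocalGroundEnergy_sdiff_pair_add_mul_le_of_constraint` (no constraint). -/
theorem semilocalGroundEnergy_sdiff_pair_add_mul_le (hh : IsWeilTest h) (hsupp : tsupport h ⊆ Icc (-δ) δ) (hδ : 0 ≤ δ)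
    (hp₁ : p₁.Prime) (hp₂ : p₂.Prime) (h1S : p₁ ∈ S) (h2S : p₂ ∈ S) (hne : p₁ ≠ p₂) (hc1 : c < Real.log p₁)
    (hd : 2 * δ < Real.log p₂ - Real.log p₁) (hd' : 2 * δ < 2 * Real.log p₁ - Real.log p₂)
    (hfit : Real.log p₂ + 2 * δ ≤ 2 * c) :
    (semilocalGroundEnergy (S \ {p₁, p₂}) (fun _ ↦ True) c +
        (Real.log p₂ / Real.sqrt p₂ + Real.sqrt ((Real.log p₂ / Real.sqrt p₂) ^ 2 + 4 * (Real.log p₁ / Real.sqrt p₁) ^ 2)) / 2) *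
      ((∑ i ∈ Finset.range 4,
          ([-1, -((Real.log p₁ / Real.sqrt p₁) /
              ((Real.log p₂ / Real.sqrt p₂ + Real.sqrt ((Real.log p₂ / Real.sqrt p₂) ^ 2 + 4 * (Real.log p₁ / Real.sqrt p₁) ^ 2)) / 2)),
            (Real.log p₁ / Real.sqrt p₁) /
              ((Real.log p₂ / Real.sqrt p₂ + Real.sqrt ((Real.log p₂ / Real.sqrt p₂) ^ 2 + 4 * (Real.log p₁ / Real.sqrt p₁) ^ 2)) / 2),
            1].getD i (0 : ℝ)) ^ 2) * ∫ u : ℝ, ‖h u‖ ^ 2) ≤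
      (weilSemilocalQuadratic S (fun t ↦ ∑ i ∈ Finset.range 4,
        (([-1, -((Real.log p₁ / Real.sqrt p₁) /
              ((Real.log p₂ / Real.sqrt p₂ + Real.sqrt ((Real.log p₂ / Real.sqrt p₂) ^ 2 + 4 * (Real.log p₁ / Real.sqrt p₁) ^ 2)) / 2)),
            (Real.log p₁ / Real.sqrt p₁) /
              ((Real.log p₂ / Real.sqrt p₂ + Real.sqrt ((Real.log p₂ / Real.sqrt p₂) ^ 2 + 4 * (Real.log p₁ / Real.sqrt p₁) ^ 2)) / 2),
            1].getD i (0 : ℝ) : ℝ) : ℂ) *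
          h (t - [-c + δ, -c + δ + (Real.log p₂ - Real.log p₁), -c + δ + Real.log p₁, -c + δ + Real.log p₂].getD i 0))).re :=
  semilocalGroundEnergy_sdiff_pair_add_mul_le_of_constraint hh hsupp hδ hp₁ hp₂ h1S h2S hne hc1 hd hd' hfit
    fun _ _ ↦ trivial

end Summit.RiemannHypothesis.RiemannHypothesis.Theorems.SemilocalDeletionPairCeiling

end
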